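import Literature.Topology.FourManifolds.BoundaryTangentLift
import Literature.Topology.FourManifolds.SPC4MorseExistence
import HarnessLib

/-!
# Gluing vector fields with boundary conditions: variable lifts, strictly inward kernel fields

Topic `Literature/Topology/FourManifolds` (vector fields on manifolds WITH boundary satisfying
pointwise convex constraints — a prescribed, variable image under the differential of a map,
tangency or strict inwardness along `∂M` — glued from local solutions by a smooth partition of
unity, Mathlib's `exists_contMDiffSection_forall_mem_convex_of_local`; sequel of
`BoundaryTangentLift.lean`; fact seat
`provefact-Literature.Geometry.Symplectic.Oba2016_s-add47373d4`: the inward Lyapunov field of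
Kas' Morse function on the total space of a Lefschetz fibration).  Everything is proved; no
definitions, no named facts.

Bröcker–Jänich, *Introduction to Differential Topology* (1982), proof of (8.12); Milnor,
*Lectures on the h-cobordism theorem* (1965), proof of Lemma 3.2 (local fields glued by a
partition of unity over a convex condition); Lee, *Introduction to Smooth Manifolds* (2012),
Prop. 8.23, Lemma 9.33 (fields tangent to / inward along the boundary).

* §1 `exists_local_lift_of_forall_mfderiv_eq'` — local lifts of a VARIABLE smooth right-hand
  side `c : M → F` through a basis of preimages (any model with corners);
* §2 (half-space models) `tangentCoordChange_apply_zero_pos` — coordinate changes preserve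
  strict inwardness at boundary points (`fderivWithin_extendCoordChange_apply_zero_pos`);
  `exists_local_kernel_field_inward` — at a boundary point where `dg` is onto on the boundary
  tangent hyperplane, a local field in `ker dg`, strictly inward along the boundary;
* §3 the global theorems: `exists_contMDiff_lift_tangent'` (tangent to `∂M` everywhere,
  `dg_x(X x) = c x` on a closed `C`, with `c` vanishing near the points of `C` where `dg` is not
  onto) and `exists_contMDiff_kernel_field_inward` (in `ker dg` on a closed `C`, strictly inward
  at the boundary points of `C`, weakly inward at all boundary points).

## References

* Th. Bröcker, K. Jänich, *Introduction to Differential Topology*, CUP 1982, (8.12) (proof).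
  [BrockerJanichIDT1982]
* J. Milnor, *Lectures on the h-cobordism theorem*, Princeton 1965, proof of Lemma 3.2.
  [MilnorHCobordism1965]
* J. M. Lee, *Introduction to Smooth Manifolds*, 2nd ed., GTM 218 (2012), Prop. 8.23,
  Lemma 9.33. [LeeSmoothManifolds2013]
-/

open scoped Manifold ContDiff Topology
open Set Function Filter Bundle

noncomputable section

namespace Literature.Topology.FourManifolds

universe u

/-! ### §1 Local lifts of a variable right-hand side -/

section General

variable {E : Type*} [NormedAddCommGroup E] [NormedSpace ℝ E]
  {H : Type*} [TopologicalSpace H] {I : ModelWithCorners ℝ E H}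
  {M : Type*} [TopologicalSpace M] [ChartedSpace H M] [IsManifold I ∞ M]
  {F : Type*} [NormedAddCommGroup F] [NormedSpace ℝ F] [FiniteDimensional ℝ F]

/-- **Local lifts of a variable right-hand side through prescribed vectors** (Bröcker–Jänich
1982, proof of (8.12)).  Let `g : M → F` be smooth, `b` a basis of `F`, vectors `v i` at `x₀`
with `dg_{x₀}(v i) = b i`, and `c : M → F` smooth on an open `U₀ ∋ x₀`.  Then on some open
`U ∋ x₀` inside `U₀` and the chart source there are smooth coefficients `a i` with
`dg_x(Σ i, a i x • parallelᵢ x) = c x` for `x ∈ U` (`parallelᵢ` the parallel section through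
`v i`); the coefficients are `b.repr (A(x)⁻¹ (c x))` for the smooth family `A(x)` of
`exists_local_lift_of_forall_mfderiv_eq`, `A(x₀) = id`.
[cite: BrockerJanichIDT1982, (8.12) (proof, local lifts)] -/
theorem exists_local_lift_of_forall_mfderiv_eq' {g : M → F} (hg : ContMDiff I 𝓘(ℝ, F) ∞ g)
    {ι : Type*} [Fintype ι] (b : Module.Basis ι ℝ F) {x₀ : M} (v : ι → E)
    (hv : ∀ i, mfderiv I 𝓘(ℝ, F) g x₀ (v i) = b i) {c : M → F} {U₀ : Set M} (hU₀ : IsOpen U₀)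
    (hx₀ : x₀ ∈ U₀) (hc : ContMDiffOn I 𝓘(ℝ, F) ∞ c U₀) :
    ∃ U : Set M, IsOpen U ∧ x₀ ∈ U ∧ U ⊆ (chartAt H x₀).source ∧ U ⊆ U₀ ∧ ∃ a : ι → M → ℝ,
      (∀ i, ContMDiffOn I 𝓘(ℝ, ℝ) ∞ (a i) U) ∧
      ∀ x ∈ U, mfderiv I 𝓘(ℝ, F) g x (∑ i, a i x • tangentCoordChange I x₀ x x (v i)) = c x := by
  classical
  set s : ι → Π x : M, TangentSpace I x := fun i x => tangentCoordChange I x₀ x x (v i) with hs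
  have hss : ∀ i, ContMDiffOn I I.tangent ∞ (fun x => (⟨x, s i x⟩ : TangentBundle I M))
      (chartAt H x₀).source := fun i => contMDiffOn_parallelSection x₀ (v i)
  set w : ι → M → F := fun i x => mfderiv I 𝓘(ℝ, F) g x (s i x) with hw
  have hws : ∀ i, ContMDiffOn I 𝓘(ℝ, F) ∞ (w i) (chartAt H x₀).source := fun i =>
    contMDiffOn_mfderiv_section hg (hss i)
  have hw₀ : ∀ i, w i x₀ = b i := fun i => by
    simp only [hw, hs, parallelSection_self]; exact hv i
  set ℓ : ι → F →L[ℝ] ℝ := fun i => LinearMap.toContinuousLinearMap (b.coord i) with hℓ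
  set A : M → F →L[ℝ] F := fun x => ∑ i, ContinuousLinearMap.smulRightL ℝ F F (ℓ i) (w i x)
    with hA
  have hA_apply : ∀ x u, A x u = ∑ i, (b.coord i u) • w i x := fun x u => by
    rw [hA, sum_apply]
    rfl
  have hAs : ContMDiffOn I 𝓘(ℝ, F →L[ℝ] F) ∞ A (chartAt H x₀).source := by
    refine contMDiffOn_finsetSum fun i _ => ?_
    exact (ContinuousLinearMap.smulRightL ℝ F F (ℓ i)).contMDiff.comp_contMDiffOn (hws i)
  have hA₀ : A x₀ = 1 := by
    ext u
    change A x₀ u = u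
    rw [hA_apply]
    simp only [hw₀, Module.Basis.coord_apply]
    exact b.sum_repr u
  set O : Set M := ((chartAt H x₀).source ∩ U₀) ∩ A ⁻¹' {f | IsUnit f} with hO
  have hOo : IsOpen O :=
    (hAs.mono inter_subset_left).continuousOn.isOpen_inter_preimage
      ((chartAt H x₀).open_source.inter hU₀) Units.isOpen
  have hx₀O : x₀ ∈ O :=
    ⟨⟨mem_chart_source H x₀, hx₀⟩, by rw [mem_preimage, mem_setOf_eq, hA₀]; exact isUnit_one⟩
  have hAinv : ∀ x ∈ O, (A x).IsInvertible := fun x hx =>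
    Literature.Analysis.ODE.isInvertible_of_isUnit hx.2
  have hinv : ContMDiffOn I 𝓘(ℝ, F →L[ℝ] F) ∞ (fun x => (A x).inverse) O := fun x hx =>
    ((hAinv x hx).contDiffAt_map_inverse (n := ∞)).comp_contMDiffWithinAt
      ((hAs x hx.1.1).mono (inter_subset_left.trans inter_subset_left))
  have hinvc : ContMDiffOn I 𝓘(ℝ, F) ∞ (fun x => (A x).inverse (c x)) O :=
    hinv.clm_apply (hc.mono (inter_subset_left.trans inter_subset_right))
  refine ⟨O, hOo, hx₀O, inter_subset_left.trans inter_subset_left,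
    inter_subset_left.trans inter_subset_right, fun i x => b.coord i ((A x).inverse (c x)),
    fun i => ?_, fun x hx => ?_⟩
  · exact ((ℓ i).contMDiff.comp_contMDiffOn hinvc).congr fun x _ => rfl
  · have h1 : mfderiv I 𝓘(ℝ, F) g x (∑ i, b.coord i ((A x).inverse (c x)) • s i x) =
        ∑ i, b.coord i ((A x).inverse (c x)) • w i x := by
      rw [map_sum]
      refine Finset.sum_congr rfl fun i _ => ?_
      rw [map_smul]
      rfl
    show mfderiv I 𝓘(ℝ, F) g x (∑ i, b.coord i ((A x).inverse (c x)) • s i x) = c x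
    rw [h1, ← hA_apply, Literature.Geometry.Manifold.apply_inverse_of_isInvertible (hAinv x hx) (c x)]

end General

/-! ### §2 Half-space models: strict inwardness, local kernel fields -/

section Boundary

variable {k : ℕ} {M : Type u} [TopologicalSpace M] [ChartedSpace (EuclideanHalfSpace (k + 1)) M]
  [IsManifold (𝓡∂ (k + 1)) ∞ M]
  {F : Type*} [NormedAddCommGroup F] [NormedSpace ℝ F]

/-- **Coordinate changes preserve strict inwardness at boundary points**: at a boundary point
`z` in the sources of the charts at `x` and `y`, a vector `v` with `v 0 > 0` (coordinates in
the chart at `x`) has `(tangentCoordChange x y z v) 0 > 0`.  Write `v = v₀ e₀ + v_t` with `v_t`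
tangent: the tangent part stays tangent (`tangentCoordChange_apply_zero_of_mem_boundary`) and
the normal derivative of the coordinate change is positive
(`fderivWithin_extendCoordChange_apply_zero_pos`). [cite: LeeSmoothManifolds2013, Prop. 5.41] -/
theorem tangentCoordChange_apply_zero_pos {x y z : M}
    (hz : z ∈ (extChartAt (𝓡∂ (k + 1)) x).source ∩ (extChartAt (𝓡∂ (k + 1)) y).source)
    (hzb : z ∈ (𝓡∂ (k + 1)).boundary M) {v : EuclideanSpace ℝ (Fin (k + 1))} (hv : 0 < v 0) :
    0 < tangentCoordChange (𝓡∂ (k + 1)) x y z v 0 := by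
  set e₀ : EuclideanSpace ℝ (Fin (k + 1)) := EuclideanSpace.single 0 1 with he₀
  set vt : EuclideanSpace ℝ (Fin (k + 1)) := v - (v 0) • e₀ with hvt
  have hvt0 : vt 0 = 0 := by simp [hvt, he₀]
  have hdecomp : v = (v 0) • e₀ + vt := by rw [hvt]; abel
  have htan : tangentCoordChange (𝓡∂ (k + 1)) x y z vt 0 = 0 :=
    tangentCoordChange_apply_zero_of_mem_boundary hz hzb hvt0
  -- positivity of the normal derivative
  have hpos : 0 < tangentCoordChange (𝓡∂ (k + 1)) x y z e₀ 0 := by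
    have hsrc : extChartAt (𝓡∂ (k + 1)) x z ∈
        ((𝓡∂ (k + 1)).extendCoordChange (chartAt (EuclideanHalfSpace (k + 1)) x)
          (chartAt (EuclideanHalfSpace (k + 1)) y)).source := by
      rw [ModelWithCorners.extendCoordChange_source]
      refine ⟨chartAt (EuclideanHalfSpace (k + 1)) x z, ?_, rfl⟩
      rw [OpenPartialHomeomorph.trans_source, OpenPartialHomeomorph.symm_source, mem_inter_iff,
        mem_preimage, (chartAt _ x).left_inv (by simpa [extChartAt_source] using hz.1)]
      exact ⟨(chartAt _ x).map_source (by simpa [extChartAt_source] using hz.1),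
        by simpa [extChartAt_source] using hz.2⟩
    have h := fderivWithin_extendCoordChange_apply_zero_pos
      (IsManifold.chart_mem_maximalAtlas (I := 𝓡∂ (k + 1)) x)
      (IsManifold.chart_mem_maximalAtlas (I := 𝓡∂ (k + 1)) y) hsrc
      (extChartAt_apply_zero_of_mem_boundary hz.1 hzb)
    rw [tangentCoordChange_def]
    exact h
  rw [hdecomp, map_add, map_smul]
  rw [PiLp.add_apply, PiLp.smul_apply, htan, add_zero, smul_eq_mul]
  exact mul_pos hv hpos

/-- A combination of the parallel section through a strictly inward vector (coefficient `1`)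
and parallel sections through tangent vectors is strictly inward at every boundary point of the
chart source. [cite: LeeSmoothManifolds2013, Prop. 5.41 and Prop. 8.23] -/
theorem halfSpaceCoord_parallel_add_sum_pos {ι : Type*} [Fintype ι] {x₀ : M}
    {u₀ : EuclideanSpace ℝ (Fin (k + 1))} (hu₀ : 0 < u₀ 0)
    {v : ι → EuclideanSpace ℝ (Fin (k + 1))} (hv : ∀ i, v i 0 = 0) (a : ι → ℝ) {x : M}
    (hx : x ∈ (chartAt (EuclideanHalfSpace (k + 1)) x₀).source) (hxb : x ∈ (𝓡∂ (k + 1)).boundary M) :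
    0 < halfSpaceCoord k (tangentCoordChange (𝓡∂ (k + 1)) x₀ x x u₀ +
      ∑ i, a i • tangentCoordChange (𝓡∂ (k + 1)) x₀ x x (v i)) := by
  have hx' : x ∈ (extChartAt (𝓡∂ (k + 1)) x₀).source := by rwa [extChartAt_source]
  rw [map_add, map_sum]
  have h1 : ∑ i, halfSpaceCoord k (a i • tangentCoordChange (𝓡∂ (k + 1)) x₀ x x (v i)) = 0 := by
    refine Finset.sum_eq_zero fun i _ => ?_
    rw [map_smul, halfSpaceCoord_apply,
      tangentCoordChange_apply_zero_of_mem_boundary ⟨hx', mem_extChartAt_source x⟩ hxb (hv i),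
      smul_zero]
  rw [h1, add_zero, halfSpaceCoord_apply]
  exact tangentCoordChange_apply_zero_pos ⟨hx', mem_extChartAt_source x⟩ hxb hu₀

variable [FiniteDimensional ℝ F]

omit [IsManifold (𝓡∂ (k + 1)) ∞ M] [FiniteDimensional ℝ F] in
/-- **A strictly inward vector in the kernel at a boundary point** where `dg` is onto on the
boundary tangent hyperplane: correct the inward unit normal `e₀` by a tangent preimage of
`dg(e₀)`. [folklore] -/
theorem exists_inward_mem_ker {g : M → F} {x₀ : M}
    (hbdry : ∀ w : F, ∃ v : EuclideanSpace ℝ (Fin (k + 1)), v 0 = 0 ∧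
      mfderiv (𝓡∂ (k + 1)) 𝓘(ℝ, F) g x₀ v = w) :
    ∃ u₀ : EuclideanSpace ℝ (Fin (k + 1)), 0 < u₀ 0 ∧ mfderiv (𝓡∂ (k + 1)) 𝓘(ℝ, F) g x₀ u₀ = 0 := by
  set e₀ : EuclideanSpace ℝ (Fin (k + 1)) := EuclideanSpace.single 0 1 with he₀
  obtain ⟨v, hv0, hv⟩ := hbdry (mfderiv (𝓡∂ (k + 1)) 𝓘(ℝ, F) g x₀ e₀)
  refine ⟨e₀ - v, by simp [he₀, hv0], ?_⟩
  have h : mfderiv (𝓡∂ (k + 1)) 𝓘(ℝ, F) g x₀ (e₀ - v) =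
      mfderiv (𝓡∂ (k + 1)) 𝓘(ℝ, F) g x₀ e₀ - mfderiv (𝓡∂ (k + 1)) 𝓘(ℝ, F) g x₀ v :=
    (mfderiv (𝓡∂ (k + 1)) 𝓘(ℝ, F) g x₀).map_sub e₀ v
  exact h.trans (by rw [hv, sub_self])

/-- **A local kernel field, strictly inward along the boundary**: at a boundary point `x₀`
where `dg` is onto on the boundary tangent hyperplane there is, on an open `U ∋ x₀`, a smooth
vector field `X` with `dg_x(X x) = 0` on `U` and `(X x) 0 > 0` at every boundary point
`x ∈ U` (the parallel section through a strictly inward kernel vector, corrected by a variable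
local lift through tangent preimages of a basis).
[cite: BrockerJanichIDT1982, (8.12) (proof)] [cite: LeeSmoothManifolds2013, Prop. 8.23] -/
theorem exists_local_kernel_field_inward {g : M → F} (hg : ContMDiff (𝓡∂ (k + 1)) 𝓘(ℝ, F) ∞ g)
    {x₀ : M} (hx₀b : x₀ ∈ (𝓡∂ (k + 1)).boundary M)
    (hbdry : ∀ w : F, ∃ v : EuclideanSpace ℝ (Fin (k + 1)), v 0 = 0 ∧
      mfderiv (𝓡∂ (k + 1)) 𝓘(ℝ, F) g x₀ v = w) :
    ∃ U : Set M, IsOpen U ∧ x₀ ∈ U ∧ ∃ X : Π x : M, TangentSpace (𝓡∂ (k + 1)) x,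
      ContMDiffOn (𝓡∂ (k + 1)) (𝓡∂ (k + 1)).tangent ∞
        (fun x => (⟨x, X x⟩ : TangentBundle (𝓡∂ (k + 1)) M)) U ∧
      (∀ x ∈ U, mfderiv (𝓡∂ (k + 1)) 𝓘(ℝ, F) g x (X x) = 0) ∧
      ∀ x ∈ U, x ∈ (𝓡∂ (k + 1)).boundary M → 0 < halfSpaceCoord k (X x) := by
  classical
  have _ := hx₀b
  set b := Module.finBasis ℝ F with hb
  choose v hv0 hv using fun i => hbdry (b i)
  obtain ⟨u₀, hu₀, hu₀k⟩ := exists_inward_mem_ker hbdry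
  -- the error `dg(parallel u₀)`, smooth on the chart source, vanishing at `x₀`
  set P : M → EuclideanSpace ℝ (Fin (k + 1)) := fun x => tangentCoordChange (𝓡∂ (k + 1)) x₀ x x u₀
    with hP
  have hPs : ContMDiffOn (𝓡∂ (k + 1)) (𝓡∂ (k + 1)).tangent ∞
      (fun x => (⟨x, P x⟩ : TangentBundle (𝓡∂ (k + 1)) M)) (chartAt _ x₀).source :=
    contMDiffOn_parallelSection x₀ u₀
  set c : M → F := fun x => - mfderiv (𝓡∂ (k + 1)) 𝓘(ℝ, F) g x (P x) with hc
  have hcs : ContMDiffOn (𝓡∂ (k + 1)) 𝓘(ℝ, F) ∞ c (chartAt _ x₀).source :=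
    (contMDiffOn_mfderiv_section hg hPs).neg
  obtain ⟨U, hUo, hx₀U, hUsub, -, a, ha, hlift⟩ :=
    exists_local_lift_of_forall_mfderiv_eq' hg b v hv (chartAt _ x₀).open_source
      (mem_chart_source _ x₀) hcs
  set S : M → EuclideanSpace ℝ (Fin (k + 1)) := fun x =>
    ∑ i, a i x • tangentCoordChange (𝓡∂ (k + 1)) x₀ x x (v i) with hS
  have hSs : ContMDiffOn (𝓡∂ (k + 1)) (𝓡∂ (k + 1)).tangent ∞
      (fun x => (⟨x, S x⟩ : TangentBundle (𝓡∂ (k + 1)) M)) U :=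
    ContMDiffOn.sum_section fun i _ =>
      (ha i).smul_section ((contMDiffOn_parallelSection x₀ (v i)).mono hUsub)
  refine ⟨U, hUo, hx₀U, fun x => P x + S x, ?_, fun x hx => ?_, fun x hx hxb => ?_⟩
  · exact (hPs.mono hUsub).add_section hSs
  · have h : mfderiv (𝓡∂ (k + 1)) 𝓘(ℝ, F) g x (P x + S x) =
        mfderiv (𝓡∂ (k + 1)) 𝓘(ℝ, F) g x (P x) + mfderiv (𝓡∂ (k + 1)) 𝓘(ℝ, F) g x (S x) :=
      (mfderiv (𝓡∂ (k + 1)) 𝓘(ℝ, F) g x).map_add (P x) (S x)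
    refine h.trans ?_
    have h2 : mfderiv (𝓡∂ (k + 1)) 𝓘(ℝ, F) g x (S x) = c x := hlift x hx
    rw [h2, hc]
    exact add_neg_cancel _
  · exact halfSpaceCoord_parallel_add_sum_pos hu₀ hv0 _ (hUsub hx) hxb

/-! ### §3 The global theorems -/

omit [IsManifold (𝓡∂ (k + 1)) ∞ M] [FiniteDimensional ℝ F] in
/-- The constraint set of the variable lift: tangent to `∂M` at boundary points, lifting `c x`
on `C`; it is convex. [folklore] -/
theorem convex_liftConstraint' (g : M → F) (C : Set M) (c : M → F) (x : M) :
    Convex ℝ {v : TangentSpace (𝓡∂ (k + 1)) x |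
      (x ∈ (𝓡∂ (k + 1)).boundary M → halfSpaceCoord k v = 0) ∧
      (x ∈ C → mfderiv (𝓡∂ (k + 1)) 𝓘(ℝ, F) g x v = c x)} :=
  convex_liftConstraint g C (c x) x

omit [IsManifold (𝓡∂ (k + 1)) ∞ M] [FiniteDimensional ℝ F] in
/-- The constraint set of the kernel field: weakly inward at boundary points, in `ker dg` on
`C` and strictly inward at the boundary points of `C`; it is convex. [folklore] -/
theorem convex_kernelConstraint (g : M → F) (C : Set M) (x : M) :
    Convex ℝ {v : TangentSpace (𝓡∂ (k + 1)) x |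
      (x ∈ (𝓡∂ (k + 1)).boundary M → 0 ≤ halfSpaceCoord k v) ∧
      (x ∈ C → mfderiv (𝓡∂ (k + 1)) 𝓘(ℝ, F) g x v = 0 ∧
        (x ∈ (𝓡∂ (k + 1)).boundary M → 0 < halfSpaceCoord k v))} := by
  intro u hu w hw p q hp hq hpq
  set L : TangentSpace (𝓡∂ (k + 1)) x →L[ℝ] ℝ := halfSpaceCoord k with hL
  have hLcomb : L (p • u + q • w) = p * L u + q * L w := by
    rw [map_add, map_smul, map_smul, smul_eq_mul, smul_eq_mul]
  refine ⟨fun hxb => ?_, fun hxC => ⟨?_, fun hxb => ?_⟩⟩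
  · have h1 : 0 ≤ L u := hu.1 hxb
    have h2 : 0 ≤ L w := hw.1 hxb
    change 0 ≤ L (p • u + q • w)
    rw [hLcomb]
    positivity
  · have h1 := (hu.2 hxC).1
    have h2 := (hw.2 hxC).1
    rw [map_add, map_smul, map_smul, h1, h2, smul_zero, smul_zero, add_zero]
  · have h1 : 0 < L u := (hu.2 hxC).2 hxb
    have h2 : 0 < L w := (hw.2 hxC).2 hxb
    change 0 < L (p • u + q • w)
    rw [hLcomb]
    rcases hp.lt_or_eq with hp' | rfl
    · nlinarith [mul_nonneg hq h2.le]
    · rw [zero_add] at hpq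
      rw [hpq, zero_mul, one_mul, zero_add]
      exact h2

variable [T2Space M] [SigmaCompactSpace M]

/-- **Lifting a variable right-hand side tangentially to the boundary** (variable form of
`exists_contMDiff_lift_tangent`).  Let `g : M → F` be smooth into a finite-dimensional space,
`c : M → F` smooth, `C ⊆ M` closed; suppose that at every interior point `x ∈ C` either `dg_x`
is onto or `c` vanishes near `x`, and that `dg_x` restricted to the boundary tangent hyperplane
is onto at every boundary point `x ∈ C`.  Then some smooth vector field `X` on `M`, tangent to
`∂M` at every boundary point, satisfies `dg_x(X x) = c x` for all `x ∈ C`.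
[cite: BrockerJanichIDT1982, (8.12) (proof)] [cite: LeeSmoothManifolds2013, Thm. 9.34] -/
theorem exists_contMDiff_lift_tangent' {g : M → F} (hg : ContMDiff (𝓡∂ (k + 1)) 𝓘(ℝ, F) ∞ g)
    {c : M → F} (hc : ContMDiff (𝓡∂ (k + 1)) 𝓘(ℝ, F) ∞ c) {C : Set M} (hC : IsClosed C)
    (hint : ∀ x ∈ C, (𝓡∂ (k + 1)).IsInteriorPoint x →
      Surjective (mfderiv (𝓡∂ (k + 1)) 𝓘(ℝ, F) g x) ∨ ∃ U ∈ 𝓝 x, ∀ y ∈ U, c y = 0)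
    (hbdry : ∀ x ∈ C, x ∈ (𝓡∂ (k + 1)).boundary M → ∀ w : F,
      ∃ v : EuclideanSpace ℝ (Fin (k + 1)), v 0 = 0 ∧ mfderiv (𝓡∂ (k + 1)) 𝓘(ℝ, F) g x v = w) :
    ∃ X : Π x : M, TangentSpace (𝓡∂ (k + 1)) x,
      ContMDiff (𝓡∂ (k + 1)) (𝓡∂ (k + 1)).tangent ∞
        (fun x => (⟨x, X x⟩ : TangentBundle (𝓡∂ (k + 1)) M)) ∧
      (∀ z ∈ (𝓡∂ (k + 1)).boundary M, halfSpaceCoord k (X z) = 0) ∧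
      ∀ x ∈ C, mfderiv (𝓡∂ (k + 1)) 𝓘(ℝ, F) g x (X x) = c x := by
  classical
  set b := Module.finBasis ℝ F with hb
  set t : ∀ x : M, Set (TangentSpace (𝓡∂ (k + 1)) x) := fun x =>
    {v | (x ∈ (𝓡∂ (k + 1)).boundary M → halfSpaceCoord k v = 0) ∧
      (x ∈ C → mfderiv (𝓡∂ (k + 1)) 𝓘(ℝ, F) g x v = c x)} with ht
  have hloc : ∀ x₀ : M, ∃ U ∈ 𝓝 x₀, ∃ X : Π x : M, TangentSpace (𝓡∂ (k + 1)) x,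
      ContMDiffOn (𝓡∂ (k + 1)) ((𝓡∂ (k + 1)).prod 𝓘(ℝ, EuclideanSpace ℝ (Fin (k + 1)))) ∞
        (fun x => TotalSpace.mk' (EuclideanSpace ℝ (Fin (k + 1))) x (X x)) U ∧
      ∀ y ∈ U, X y ∈ t y := by
    intro x₀
    by_cases hx₀C : x₀ ∈ C
    · by_cases hx₀b : x₀ ∈ (𝓡∂ (k + 1)).boundary M
      · choose v hv0 hv using fun i => hbdry x₀ hx₀C hx₀b (b i)
        obtain ⟨U, hUo, hx₀U, hUsub, -, a, ha, hlift⟩ :=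
          exists_local_lift_of_forall_mfderiv_eq' hg b v hv isOpen_univ (mem_univ _) hc.contMDiffOn
        refine ⟨U, hUo.mem_nhds hx₀U,
          fun x => ∑ i, a i x • tangentCoordChange (𝓡∂ (k + 1)) x₀ x x (v i),
          ?_, fun y hy => ⟨fun hyb => ?_, fun _ => hlift y hy⟩⟩
        · exact ContMDiffOn.sum_section fun i _ =>
            (ha i).smul_section ((contMDiffOn_parallelSection x₀ (v i)).mono hUsub)
        · exact halfSpaceCoord_sum_smul_parallelSection_eq_zero hx₀b hv0 _ (hUsub hy) hyb
      · have hx₀i : (𝓡∂ (k + 1)).IsInteriorPoint x₀ := by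
          by_contra h
          exact hx₀b (((𝓡∂ (k + 1)).isBoundaryPoint_iff_not_isInteriorPoint x₀).2 h)
        rcases hint x₀ hx₀C hx₀i with hsurj | ⟨U₁, hU₁, hcU₁⟩
        · have hsurj' : ∀ w : F, ∃ v : EuclideanSpace ℝ (Fin (k + 1)),
              mfderiv (𝓡∂ (k + 1)) 𝓘(ℝ, F) g x₀ v = w := fun w => hsurj w
          choose v hv using fun i => hsurj' (b i)
          obtain ⟨U, hUo, hx₀U, hUsub, -, a, ha, hlift⟩ :=
            exists_local_lift_of_forall_mfderiv_eq' hg b v hv isOpen_univ (mem_univ _) hc.contMDiffOn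
          refine ⟨U ∩ (𝓡∂ (k + 1)).interior M,
            (hUo.inter (ModelWithCorners.isOpen_interior (I := 𝓡∂ (k + 1)) (M := M) (n := ∞)
              (by simp))).mem_nhds ⟨hx₀U, hx₀i⟩,
            fun x => ∑ i, a i x • tangentCoordChange (𝓡∂ (k + 1)) x₀ x x (v i),
            ?_, fun y hy => ⟨fun hyb => ?_, fun _ => hlift y hy.1⟩⟩
          · exact (ContMDiffOn.sum_section fun i _ =>
              (ha i).smul_section ((contMDiffOn_parallelSection x₀ (v i)).mono hUsub)).mono
              inter_subset_left
          · exact absurd hy.2 (((𝓡∂ (k + 1)).isBoundaryPoint_iff_not_isInteriorPoint y).1 hyb)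
        · -- `c` vanishes near `x₀`: the zero field
          refine ⟨U₁, hU₁, fun _ => 0,
            (contMDiff_zeroSection ℝ (TangentSpace (𝓡∂ (k + 1)) : M → Type _)).contMDiffOn,
            fun y hy => ⟨fun _ => map_zero _, fun _ => ?_⟩⟩
          exact (map_zero _).trans (hcU₁ y hy).symm
    · refine ⟨Cᶜ, hC.isOpen_compl.mem_nhds hx₀C, fun _ => 0,
        (contMDiff_zeroSection ℝ (TangentSpace (𝓡∂ (k + 1)) : M → Type _)).contMDiffOn, fun y hy =>
        ⟨fun _ => map_zero _, fun hyC => absurd hyC hy⟩⟩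
  obtain ⟨s, hs⟩ := exists_contMDiffSection_forall_mem_convex_of_local (n := (⊤ : ℕ∞)) (𝓡∂ (k + 1))
    (fun x => TangentSpace (𝓡∂ (k + 1)) x) t (fun x => convex_liftConstraint' g C c x) hloc
  exact ⟨s, s.contMDiff, fun z hz => (hs z).1 hz, fun x hx => (hs x).2 hx⟩

/-- **A kernel field, strictly inward along the boundary** (the field `ν` normal to the
horizontal boundary of a fibration, inside the fibres).  Let `g : M → F` be smooth into a
finite-dimensional space and `C ⊆ M` closed such that at every boundary point `x ∈ C` the
differential `dg_x` is onto already on the boundary tangent hyperplane.  Then some smooth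
vector field `X` on `M` is weakly inward at every boundary point (`(X z) 0 ≥ 0`), lies in
`ker dg_x` for all `x ∈ C`, and is strictly inward (`(X x) 0 > 0`) at every boundary point of
`C`.  (Local fields: zero off `C` and at interior points of `C`;
`exists_local_kernel_field_inward` at boundary points of `C`; glued over the convex constraint
sets `convex_kernelConstraint`.) [cite: LeeSmoothManifolds2013, Prop. 8.23, Lemma 9.33]
[cite: MilnorHCobordism1965, Lemma 3.2 (proof)] -/
theorem exists_contMDiff_kernel_field_inward {g : M → F}
    (hg : ContMDiff (𝓡∂ (k + 1)) 𝓘(ℝ, F) ∞ g) {C : Set M} (hC : IsClosed C)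
    (hbdry : ∀ x ∈ C, x ∈ (𝓡∂ (k + 1)).boundary M → ∀ w : F,
      ∃ v : EuclideanSpace ℝ (Fin (k + 1)), v 0 = 0 ∧ mfderiv (𝓡∂ (k + 1)) 𝓘(ℝ, F) g x v = w) :
    ∃ X : Π x : M, TangentSpace (𝓡∂ (k + 1)) x,
      ContMDiff (𝓡∂ (k + 1)) (𝓡∂ (k + 1)).tangent ∞
        (fun x => (⟨x, X x⟩ : TangentBundle (𝓡∂ (k + 1)) M)) ∧
      (∀ z ∈ (𝓡∂ (k + 1)).boundary M, 0 ≤ halfSpaceCoord k (X z)) ∧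
      (∀ x ∈ C, mfderiv (𝓡∂ (k + 1)) 𝓘(ℝ, F) g x (X x) = 0) ∧
      ∀ x ∈ C, x ∈ (𝓡∂ (k + 1)).boundary M → 0 < halfSpaceCoord k (X x) := by
  classical
  set t : ∀ x : M, Set (TangentSpace (𝓡∂ (k + 1)) x) := fun x =>
    {v | (x ∈ (𝓡∂ (k + 1)).boundary M → 0 ≤ halfSpaceCoord k v) ∧
      (x ∈ C → mfderiv (𝓡∂ (k + 1)) 𝓘(ℝ, F) g x v = 0 ∧
        (x ∈ (𝓡∂ (k + 1)).boundary M → 0 < halfSpaceCoord k v))} with ht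
  have hloc : ∀ x₀ : M, ∃ U ∈ 𝓝 x₀, ∃ X : Π x : M, TangentSpace (𝓡∂ (k + 1)) x,
      ContMDiffOn (𝓡∂ (k + 1)) ((𝓡∂ (k + 1)).prod 𝓘(ℝ, EuclideanSpace ℝ (Fin (k + 1)))) ∞
        (fun x => TotalSpace.mk' (EuclideanSpace ℝ (Fin (k + 1))) x (X x)) U ∧
      ∀ y ∈ U, X y ∈ t y := by
    intro x₀
    by_cases hx₀C : x₀ ∈ C
    · by_cases hx₀b : x₀ ∈ (𝓡∂ (k + 1)).boundary M
      · obtain ⟨U, hUo, hx₀U, X, hXs, hXk, hXin⟩ :=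
          exists_local_kernel_field_inward hg hx₀b (hbdry x₀ hx₀C hx₀b)
        exact ⟨U, hUo.mem_nhds hx₀U, X, hXs, fun y hy =>
          ⟨fun hyb => (hXin y hy hyb).le, fun _ => ⟨hXk y hy, fun hyb => hXin y hy hyb⟩⟩⟩
      · have hx₀i : (𝓡∂ (k + 1)).IsInteriorPoint x₀ := by
          by_contra h
          exact hx₀b (((𝓡∂ (k + 1)).isBoundaryPoint_iff_not_isInteriorPoint x₀).2 h)
        refine ⟨(𝓡∂ (k + 1)).interior M,
          (ModelWithCorners.isOpen_interior (I := 𝓡∂ (k + 1)) (M := M) (n := ∞) (by simp)).mem_nhds hx₀i,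
          fun _ => 0, (contMDiff_zeroSection ℝ (TangentSpace (𝓡∂ (k + 1)) : M → Type _)).contMDiffOn,
          fun y hy => ⟨fun _ => le_of_eq (map_zero _).symm, fun _ => ⟨map_zero _, fun hyb => ?_⟩⟩⟩
        exact absurd hy (((𝓡∂ (k + 1)).isBoundaryPoint_iff_not_isInteriorPoint y).1 hyb)
    · refine ⟨Cᶜ, hC.isOpen_compl.mem_nhds hx₀C, fun _ => 0,
        (contMDiff_zeroSection ℝ (TangentSpace (𝓡∂ (k + 1)) : M → Type _)).contMDiffOn, fun y hy =>
        ⟨fun _ => le_of_eq (map_zero _).symm, fun hyC => absurd hyC hy⟩⟩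
  obtain ⟨s, hs⟩ := exists_contMDiffSection_forall_mem_convex_of_local (n := (⊤ : ℕ∞)) (𝓡∂ (k + 1))
    (fun x => TangentSpace (𝓡∂ (k + 1)) x) t (fun x => convex_kernelConstraint g C x) hloc
  exact ⟨s, s.contMDiff, fun z hz => (hs z).1 hz, fun x hx => ((hs x).2 hx).1,
    fun x hx hxb => ((hs x).2 hx).2 hxb⟩

end Boundary

end Literature.Topology.FourManifolds

end
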